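import Summits.QuantumFields.YangMills.Theorems.UnitScaleTiltProp7StubEXOfDisplayedRowsW
import Summits.QuantumFields.YangMills.Theorems.UnitScaleTiltProp7ChartPiecesTw
import Summits.QuantumFields.YangMills.Theorems.UnitScaleTiltProp7ChartSigmaT3OfRegPr
import Summits.QuantumFields.YangMills.Theorems.UnitScaleTiltProp7Bound20SymLog
import HarnessLib

/-!
# Route `UnitScaleTilt`, crux K1 child «MinimiserStabilityRegPr» (stmt-QuantumFields-19200), skeleton v10, stub `stub_existenceMinimalOrbit` (EX), route (α) — **(CH-KNIT v2-tw), FAMILY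
# LEVEL: THE EX KNIT OF RECORD FOR THE TWISTED CHART** (OWNER RULING g26-№1 Σ-TWIST (T), knit target (4)): the REGISTERED text of `stub_existenceMinimalOrbit` as ONE kernel statement,
# `Prop7StubEXOfDisplayedRowsW.stubEX_of_displayedRows_w` (p606029) at the chart of record (`periodsT3`∕`siteEquiv`∕`bgOfCfg`) with the datum letter FIXED to `B(V, U₀) := Bsym =
# (1/i)·log(V·Ū₀^*)` on `Λ_k = PBond (P n) 0` — its (B20) row DISCHARGED by ★w4-19200 g2's `Prop7Bound20SymLog.bound20_symLog_of_closeAvg` (p603003) inside the WS window, and its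
# CHART-112 row DISCHARGED by `Prop7ChartPiecesTw.hChart_of_piecesTw` ∘ ★w5 g0's `chartSigmaT3_of_regPr`: what stays displayed is print's own node list in the TWISTED letters —
# N06 ×2, Prop. 4, (46)-tw (∃ right inverse of `Q(U₀) = QTw U₀`), Prop. 3-tw, the twisted-average `log` window, (CH5EL-tw), the Σ ∕ size ∕ regularity windows, the (γ)-growth input,
# the Thm 2 torus sockets

Cell `ym3-torus`, width seat `ym-ust-19200-w2` (gen 3; KNIT RULER per ★★OWNER g26 RULING №1 (4), ACK 4 (a); LOCATE line 05:14Z).  THEOREMS ONLY (0 `def`, 0 `sorry`).  CONDITIONAL: the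
stub stays OPEN; `--supports stmt-QuantumFields-19200 --as helper`, count-neutral.  YM₃ on T³ is a ladder rung (R3), not the Clay problem; nothing here claims the stub, the crux, d = 4
or the mass gap.

THE KNIT (no new analysis).  Member by member (`i = (F, n, K)`, `B₃* = 3L`, background radius `a = L³·3L·ε₁ ≤ α`): `RegPr a U₀ ⟹ RegPr α U₀` (`regPr_mono`); (46)-tw gives a right
inverse `H` of `QTw U₀` with `‖H‖ ≤ B_H`; Prop. 3-tw gives `Chart47T3tw … (C₂)_i ε_i U₀ H`; CHART-Σ at `(α, e)` is ★w5 g0's `chartSigmaT3_of_regPr` in its windows; (B20) at the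
letter `Bsym` holds by (14) under `L³ε₁ ≤ α∕(3L) ≤ 1∕48` (WS: `2α ≤ ⅛`), so `‖H₁B‖ ≤ 2B₀α` and `M(r + ‖H₁B‖) < e`; `Prop7ChartPiecesTw.hChart_of_piecesTw` assembles CHART-112 with
(20) a THEOREM (★w5-20520 g3's `fibreClause_of_chart47tw`); then `stubEX_of_displayedRows_w`.

DISPLAYED ROWS of ★★★ **`stubEX_of_chartPiecesTw`** (everything else is a kernel theorem of the tree; chart-side letters are print's RESTRICTED ∕ TWISTED ones — interface
principle (7) of RULING g26-№1): (N06) `norm_G`, `norm_H₁` ([Balaban1985BackgroundPropagators] Thms 3.13 ∕ 3.12; `H₁` on data indexed by `Λ_k`); (P4) `prop4`; **(46)-tw** `h46tw` — at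
every `U₀ ∈ 𝔘_k(α)` a `ℂ`-linear right inverse `H` of `Q(U₀) = QTw U₀` with `‖HY‖ ≤ B_H‖Y‖` ([Balaban1985Variational] (45)–(46); suppliers (R1) + (3e) of RULING g26-№1); **(CH47-tw)**
`h47tw` — Prop. 3 for the twisted chart as an implication from (45)–(46) (supplier: the (44)-tw input, not built — RULING №1 (5)); **(WIN-tw)** `hwinTw` — the `log` window of the twisted
average at chart points of (19)-size `< e` (supplier located: `Prop7SymAvgRelativeBoundT3.norm_relIter_sub_one_le_T3` + a frame bound); **(CH5EL-tw)** `hXtw` — (112) ∘ Prop. 5 ∘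
(123)–(140) ∘ (102)–(103) ∘ E–L for that `H` (XL); (WΣ) `hwS` — the nine windows of `chartSigmaT3_of_regPr` VERBATIM; (WMe) `M(r + 2B₀α) < e`; **(W137)** `10⁷L³·178(α + e) ≤ 1`
(regularity radii of `U₀` and of the chart point for the log-chart bridges); (GR) `hGrowth`; (T2) `hThm2`.  GONE w.r.t. the v1 knit `stubEX_of_chartPieces` (p601708): (B20) (a
theorem now), (W47) and the free letters `Hf`∕`hH`∕`Bf`∕`β` (the comb chart is not the chart of record; `H` lives behind the ∃ of (46)-tw; `B := Bsym`).

References: T. Bałaban, CMP 102 (1985) 277–309 [Balaban1985Variational] (Prop. 3 p.289, (44)–(49) p.285, Prop. 5 p.294, (102)–(103) p.293, (111)–(112) p.294, (123)–(142)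
pp.296–299, Prop. 7 p.299, (20) p.281); CMP 99 (1985) 75–102 [Balaban1985RegularSpaces] ((1.29)–(1.31) pp.81–82, (1.37) p.82, Thm 2 p.83, Prop. 7 p.98); CMP 99 (1985) 389–434
[Balaban1985BackgroundPropagators] (p.392, Thms 3.12–3.13); CMP 98 (1985) 17–51 [Balaban1985Averaging] ((89)–(92) p.31, Props 4–5 pp.38–42).
-/

set_option autoImplicit false

noncomputable section

open scoped BigOperators Matrix.Norms.L2Operator Matrix

namespace Summit.QuantumFields.YangMills.Theorems.Prop7StubEXOfChartPiecesTw

open NormedSpace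
open Literature.MathematicalPhysics.QuantumFieldTheory.Balaban1983to89
open Literature.MathematicalPhysics.QuantumFieldTheory.Balaban1983to89.T3ContinuumYM3Torus
open Literature.MathematicalPhysics.QuantumFieldTheory.Balaban1983to89.T3UnitLawDensityEML (ℰp)
open Literature.MathematicalPhysics.QuantumFieldTheory.Balaban1983to89.T3TiltDescent (descendTo)
open Literature.MathematicalPhysics.QuantumFieldTheory.Balaban1983to89.T3ConstrainedMinimiser (fibre)
open Literature.MathematicalPhysics.QuantumFieldTheory.Balaban1983to89.T3PrintedRegularMinimiser (RegPr regFibrePr)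
open Literature.MathematicalPhysics.QuantumFieldTheory.Balaban1983to89.T3PrintedRegularOrbits (descTransf)
open Literature.MathematicalPhysics.QuantumFieldTheory.Balaban1983to89.T3PrintedMinimiserExistence (regPr_mono)
open Literature.MathematicalPhysics.QuantumFieldTheory.Balaban1983to89.T3Thm1Carrier
open Literature.MathematicalPhysics.QuantumFieldTheory.Balaban1983to89.T3SectALandauChart (In19 emb15 CloseAvg eta)
open BlockAveragingEMLLinearisedBackground (pertVar)
open B9SectCLatticeCarrier (Bond)
open B10Eq27TorusAxialLog (unitsField toUField)
open B11Eq115Space (NegSize Space115)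
open B11Eq111FrakG (nabla115)
open B11Eq98CurrentSlot (Jcur)
open B11Prop3Model (Dfix)
open B13Contraction113 (QuadAnalytic)
open B8Thm2TorusAt (Thm2TorusAt)
open B7Prop2SpecialUnitary (specialUnitaryUnits)
open B7Prop2Explicit (C0 c2')
open B7Prop3Flat (c3)
open MatrixLog (mlog)
open Summit.QuantumFields.YangMills.Theorems.Prop7TPrint (nMax19 expHermField)
open Summit.QuantumFields.YangMills.Theorems.Prop7SPrint (AvgCondPrint IsLandauPrint RestrictedPrint IsAxialPrint)
open Summit.QuantumFields.YangMills.Theorems.Prop7SectET3Transport (periodsT3 siteEquiv siteEquiv_shiftEquiv bgOfCfg)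
open Summit.QuantumFields.YangMills.Theorems.Prop7ChartT3 (ChartSigmaT3)
open Summit.QuantumFields.YangMills.Theorems.Prop7ChartSigmaT3OfRegPr (chartSigmaT3_of_regPr)
open Summit.QuantumFields.YangMills.Theorems.Prop7SymAvgTw (dbarTw QTw CmapTw Chart47T3tw)
open Summit.QuantumFields.YangMills.Theorems.Prop7Bound20SymLog (bound20_symLog_of_closeAvg)
open Summit.QuantumFields.YangMills.Theorems.Prop7ChartPiecesTw (hChart_of_piecesTw)
open Summit.QuantumFields.YangMills.Theorems.Prop7StubEXOfDisplayedRowsW (stubEX_of_displayedRows_w)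

/-- ★★★ **`stub_existenceMinimalOrbit`'s REGISTERED TEXT FROM THE TWISTED CHART PIECES** — `stubEX_of_displayedRows_w` (p606029) at the chart of record with `B := Bsym = (1/i)·log(V·Ū₀^*)`
on `Λ_k`, its (B20) row DISCHARGED (`Prop7Bound20SymLog.bound20_symLog_of_closeAvg`, window from WS) and its CHART-112 row DISCHARGED (`Prop7ChartPiecesTw.hChart_of_piecesTw` ∘
`Prop7ChartSigmaT3OfRegPr.chartSigmaT3_of_regPr`, both via `regPr_mono` at the radius `α L`; (20) inside is ★w5-20520 g3's theorem `fibreClause_of_chart47tw`).  Displayed: N06 ×2,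
Prop. 4, (46)-tw `h46tw`, Prop. 3-tw `h47tw`, the twisted-average `log` window `hwinTw`, (CH5EL-tw) `hXtw`, the windows (WΣ)∕(WMe)∕(W137), the (γ)-growth input, the Thm 2 torus
sockets.  CONDITIONAL — the stub is not closed. [cite: Balaban1985Variational, Prop. 7 p.299, Prop. 3 p.289, (45)-(49) p.285, Prop. 5 p.294, Prop. 6 p.295, (102)-(103) p.293, (141)-(142) p.299, (20) p.281; Balaban1985RegularSpaces, Thm 2 p.83, (1.29) p.81, (1.37) p.82, Prop. 7 p.98] -/
theorem stubEX_of_chartPiecesTw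
    [hFL : ∀ F : T3Family, Fact (0 < (F.L : ℝ))] [hFη : ∀ (F : T3Family) (k : ℕ), Fact (0 < ((F.L : ℝ)⁻¹) ^ k)]
    -- the constants, member-uniform at each `L` (print: «absolute constants depending on d and L only»)
    (B₀ C₄ a₃ α r M CP θ cS : ℕ → ℝ) (hB₀ : ∀ L, 1 < L → 0 < B₀ L) (hC₄ : ∀ L, 1 < L → 0 < C₄ L) (ha₃ : ∀ L, 1 < L → 0 < a₃ L)
    (hα : ∀ L, 1 < L → 0 < α L) (hr : ∀ L, 1 < L → 0 < r L) (hM : ∀ L, 1 < L → 0 < M L) (hCP : ∀ L, 1 < L → 0 < CP L)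
    (hθ : ∀ L, 1 < L → θ L < 1 / 2) (hcS : ∀ L, 1 < L → 0 ≤ cS L)
    -- the curved letters `𝔊(U₀)`, `(δ/δA′)V`, `H₁(U₀)`, OPAQUE (the datum `B` is FIXED to `Bsym` on `Λ_k = PBond (P n) 0`)
    (𝒢f : ∀ (L : ℕ) (i : Idx L) (U₀ : GaugeField (i.1.1.P i.1.2.2) 0 (Matrix.specialUnitaryGroup (Fin 2) ℂ)),
      NegSize (i.1.1.L : ℝ) (((i.1.1.L : ℝ)⁻¹) ^ (i.1.2.2 - i.1.2.1)) (fun _ : Bond 3 (periodsT3 i.1.1 i.1.2.2) => i.1.2.2 - i.1.2.1) 3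
          (Matrix (Fin 2) (Fin 2) ℂ) →L[ℂ]
        Space115 (i.1.1.L : ℝ) (((i.1.1.L : ℝ)⁻¹) ^ (i.1.2.2 - i.1.2.1)) (fun _ : Bond 3 (periodsT3 i.1.1 i.1.2.2) => i.1.2.2 - i.1.2.1)
          (fun _ : Bond 3 (periodsT3 i.1.1 i.1.2.2) × Fin 3 => i.1.2.2 - i.1.2.1) (nabla115 (((i.1.1.L : ℝ)⁻¹) ^ (i.1.2.2 - i.1.2.1)) (bgOfCfg i.1.1 i.1.2.2 U₀)))
    (Wf : ∀ (L : ℕ) (i : Idx L) (U₀ : GaugeField (i.1.1.P i.1.2.2) 0 (Matrix.specialUnitaryGroup (Fin 2) ℂ)),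
      Space115 (i.1.1.L : ℝ) (((i.1.1.L : ℝ)⁻¹) ^ (i.1.2.2 - i.1.2.1)) (fun _ : Bond 3 (periodsT3 i.1.1 i.1.2.2) => i.1.2.2 - i.1.2.1)
          (fun _ : Bond 3 (periodsT3 i.1.1 i.1.2.2) × Fin 3 => i.1.2.2 - i.1.2.1) (nabla115 (((i.1.1.L : ℝ)⁻¹) ^ (i.1.2.2 - i.1.2.1)) (bgOfCfg i.1.1 i.1.2.2 U₀)) →
        NegSize (i.1.1.L : ℝ) (((i.1.1.L : ℝ)⁻¹) ^ (i.1.2.2 - i.1.2.1)) (fun _ : Bond 3 (periodsT3 i.1.1 i.1.2.2) => i.1.2.2 - i.1.2.1) 3 (Matrix (Fin 2) (Fin 2) ℂ))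
    (H₁f : ∀ (L : ℕ) (i : Idx L) (U₀ : GaugeField (i.1.1.P i.1.2.2) 0 (Matrix.specialUnitaryGroup (Fin 2) ℂ)),
      (PBond (i.1.1.P i.1.2.1) 0 → Matrix (Fin 2) (Fin 2) ℂ) →L[ℂ]
        Space115 (i.1.1.L : ℝ) (((i.1.1.L : ℝ)⁻¹) ^ (i.1.2.2 - i.1.2.1)) (fun _ : Bond 3 (periodsT3 i.1.1 i.1.2.2) => i.1.2.2 - i.1.2.1)
          (fun _ : Bond 3 (periodsT3 i.1.1 i.1.2.2) × Fin 3 => i.1.2.2 - i.1.2.1) (nabla115 (((i.1.1.L : ℝ)⁻¹) ^ (i.1.2.2 - i.1.2.1)) (bgOfCfg i.1.1 i.1.2.2 U₀)))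
    -- their displayed bounds (the `SectEDatum` fields at admissible backgrounds)
    (norm_G : ∀ (L : ℕ), 1 < L → ∀ (i : Idx L) (ρ : ℝ) (U₀ : GaugeField (i.1.1.P i.1.2.2) 0 (Matrix.specialUnitaryGroup (Fin 2) ℂ)),
      RegPr i.1.1 i.1.2.1 i.1.2.2 ρ U₀ → ρ ≤ α L → ∀ f, ‖𝒢f L i U₀ f‖ ≤ B₀ L * ‖f‖)
    (prop4 : ∀ (L : ℕ), 1 < L → ∀ (i : Idx L) (ρ : ℝ) (U₀ : GaugeField (i.1.1.P i.1.2.2) 0 (Matrix.specialUnitaryGroup (Fin 2) ℂ)),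
      RegPr i.1.1 i.1.2.1 i.1.2.2 ρ U₀ → ρ ≤ α L → QuadAnalytic (Wf L i U₀) (C₄ L) (a₃ L))
    (norm_H₁ : ∀ (L : ℕ), 1 < L → ∀ (i : Idx L) (ρ : ℝ) (U₀ : GaugeField (i.1.1.P i.1.2.2) 0 (Matrix.specialUnitaryGroup (Fin 2) ℂ)),
      RegPr i.1.1 i.1.2.1 i.1.2.2 ρ U₀ → ρ ≤ α L → ∀ b, ‖H₁f L i U₀ b‖ ≤ B₀ L * ‖b‖)
    -- (46)-tw: a right inverse `H` of print's averaging operator `Q(U₀) = QTw U₀` with its bound, at every admissible background (DISPLAYED; suppliers (R1) + (3e))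
    (BH : ℕ → ℝ)
    (h46tw : ∀ (L : ℕ), 1 < L → ∀ (i : Idx L) (U₀ : GaugeField (i.1.1.P i.1.2.2) 0 (Matrix.specialUnitaryGroup (Fin 2) ℂ)), RegPr i.1.1 i.1.2.1 i.1.2.2 (α L) U₀ →
      ∃ H : (PBond (i.1.1.P i.1.2.1) 0 → Matrix (Fin 2) (Fin 2) ℂ) →ₗ[ℂ] (PBond (i.1.1.P i.1.2.2) 0 → Matrix (Fin 2) (Fin 2) ℂ),
        (∀ Y, QTw i.1.1 i.1.2.1 i.1.2.2 i.2.2.le U₀ (H Y) = Y) ∧ ∀ Y, ‖H Y‖ ≤ BH L * ‖Y‖)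
    -- (CH47-tw): Prop. 3 for the twisted chart as an implication from (45)–(46), member-wise constants `C₂`, `ε = ε₃` (DISPLAYED; supplier = the (44)-tw input, not built)
    (C2f εf : ∀ (L : ℕ), Idx L → ℝ)
    (h47tw : ∀ (L : ℕ), 1 < L → ∀ (i : Idx L) (U₀ : GaugeField (i.1.1.P i.1.2.2) 0 (Matrix.specialUnitaryGroup (Fin 2) ℂ))
      (H : (PBond (i.1.1.P i.1.2.1) 0 → Matrix (Fin 2) (Fin 2) ℂ) →ₗ[ℂ] (PBond (i.1.1.P i.1.2.2) 0 → Matrix (Fin 2) (Fin 2) ℂ)), RegPr i.1.1 i.1.2.1 i.1.2.2 (α L) U₀ →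
      (∀ Y, QTw i.1.1 i.1.2.1 i.1.2.2 i.2.2.le U₀ (H Y) = Y) → (∀ Y, ‖H Y‖ ≤ BH L * ‖Y‖) → Chart47T3tw i.1.1 i.1.2.1 i.1.2.2 i.2.2.le (C2f L i) (εf L i) U₀ H)
    -- the windows of `Prop7ChartSigmaT3OfRegPr.chartSigmaT3_of_regPr` at `(ε₀, e) := (α L, e L)` (verbatim from the v1 knit)
    (ef : ℕ → ℝ) (hef : ∀ L, 1 < L → 0 < ef L)
    (hwS : ∀ (L : ℕ), 1 < L → ∀ i : Idx L,
      C0 (i.1.1.P i.1.2.2).d * (2 * α L) ≤ 1 / 3 ∧ 4 * (2 * α L) ≤ c2' (i.1.1.P i.1.2.2).d (i.1.1.P i.1.2.2).L ∧ 2 * α L ≤ 1 / 8 ∧ ef L ≤ 1 / 20 ∧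
      Real.exp (4 * (800 * ((((i.1.1.P i.1.2.2).d : ℕ) : ℝ) + 1) ^ 2 * ((((i.1.1.P i.1.2.2).d : ℕ) : ℝ) + 4)) * (2 * α L))
        * (1 + 8 * (131072 * ((((i.1.1.P i.1.2.2).d : ℕ) : ℝ) + 1) ^ 2) * ef L) ≤ 2 ∧
      2 * ef L ≤ c3 (i.1.1.P i.1.2.2).d (i.1.1.P i.1.2.2).L ∧ 2048 * (((i.1.1.P i.1.2.2).d : ℕ) : ℝ) * ef L ≤ 1 ∧
      C0 (i.1.1.P i.1.2.2).d * (2 * α L + 4 * ef L) ≤ 1 / 3 ∧ 2 * (2 * α L + 4 * ef L) ≤ c2' (i.1.1.P i.1.2.2).d (i.1.1.P i.1.2.2).L)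
    -- the size window linking (CH5EL-tw)'s size row to CHART-Σ's radius, and the regularity window of the log-chart bridges
    (hMe : ∀ L, 1 < L → M L * (r L + 2 * B₀ L * α L) < ef L)
    (hw137 : ∀ L : ℕ, 1 < L → 10 ^ 7 * (L : ℝ) ^ 3 * (178 * (α L + ef L)) ≤ 1)
    -- (WIN-tw): the `log` window of the twisted average at chart points of (19)-size `< e` (DISPLAYED; supplier located)
    (hwinTw : ∀ (L : ℕ), 1 < L → ∀ (i : Idx L) (U₀ : GaugeField (i.1.1.P i.1.2.2) 0 (Matrix.specialUnitaryGroup (Fin 2) ℂ)) (X : PBond (i.1.1.P i.1.2.2) 0 → Matrix (Fin 2) (Fin 2) ℂ),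
      RegPr i.1.1 i.1.2.1 i.1.2.2 (α L) U₀ → (∀ b : PBond (i.1.1.P i.1.2.2) 0, (X b).IsHermitian ∧ Matrix.trace (X b) = 0) → nMax19 i.1.1 i.1.2.1 i.1.2.2 U₀ X < ef L →
      ∀ c : PBond (i.1.1.P i.1.2.1) 0, ‖((dbarTw i.1.1 i.1.2.1 i.1.2.2 i.2.2.le U₀ (fun b => Complex.I • X b) c : (Matrix (Fin 2) (Fin 2) ℂ)ˣ) : Matrix (Fin 2) (Fin 2) ℂ) - 1‖ < 1)
    -- (CH5EL-tw): (112) ∘ Prop. 5 ∘ (123)–(140) ∘ (102)–(103) ∘ E–L in the twisted letters, for the `H` of (46)-tw (DISPLAYED, XL)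
    (hXtw : ∀ (L : ℕ), 1 < L → ∀ (i : Idx L) (ε₁ : ℝ) (V : GaugeField (i.1.1.P i.1.2.1) 0 (Matrix.specialUnitaryGroup (Fin 2) ℂ))
      (U₀ : GaugeField (i.1.1.P i.1.2.2) 0 (Matrix.specialUnitaryGroup (Fin 2) ℂ))
      (H : (PBond (i.1.1.P i.1.2.1) 0 → Matrix (Fin 2) (Fin 2) ℂ) →ₗ[ℂ] (PBond (i.1.1.P i.1.2.2) 0 → Matrix (Fin 2) (Fin 2) ℂ)), 0 < ε₁ → PlaqSmall ε₁ V →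
      RegPr i.1.1 i.1.2.1 i.1.2.2 ((L : ℝ) ^ 3 * (3 * (L : ℝ)) * ε₁) U₀ → CloseAvg i.1.1 i.1.2.1 i.1.2.2 i.2.2.le ((L : ℝ) ^ 3 * ε₁) V U₀ → (L : ℝ) ^ 3 * (3 * (L : ℝ)) * ε₁ ≤ α L →
      (∀ Y, QTw i.1.1 i.1.2.1 i.1.2.2 i.2.2.le U₀ (H Y) = Y) → (∀ Y, ‖H Y‖ ≤ BH L * ‖Y‖) → Chart47T3tw i.1.1 i.1.2.1 i.1.2.2 i.2.2.le (C2f L i) (εf L i) U₀ H →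
      ∀ A₁ : Space115 (i.1.1.L : ℝ) (((i.1.1.L : ℝ)⁻¹) ^ (i.1.2.2 - i.1.2.1)) (fun _ : Bond 3 (periodsT3 i.1.1 i.1.2.2) => i.1.2.2 - i.1.2.1)
          (fun _ : Bond 3 (periodsT3 i.1.1 i.1.2.2) × Fin 3 => i.1.2.2 - i.1.2.1) (nabla115 (((i.1.1.L : ℝ)⁻¹) ^ (i.1.2.2 - i.1.2.1)) (bgOfCfg i.1.1 i.1.2.2 U₀)),
        ‖A₁‖ < r L →
        A₁ + 𝒢f L i U₀ (Jcur (bgOfCfg i.1.1 i.1.2.2 U₀)) + 𝒢f L i U₀ (Wf L i U₀ (A₁ + H₁f L i U₀ (fun c : PBond (i.1.1.P i.1.2.1) 0 =>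
          (-Complex.I) • mlog (((V c : Matrix.specialUnitaryGroup (Fin 2) ℂ) : Matrix (Fin 2) (Fin 2) ℂ)
            * star ((descendTo i.1.1 ℰp i.1.2.1 i.1.2.2 i.2.2.le U₀ c : Matrix.specialUnitaryGroup (Fin 2) ℂ) : Matrix (Fin 2) (Fin 2) ℂ))))) = 0 →
        ∃ (A' : PBond (i.1.1.P i.1.2.2) 0 → Matrix (Fin 2) (Fin 2) ℂ) (X : PBond (i.1.1.P i.1.2.2) 0 → Matrix (Fin 2) (Fin 2) ℂ),
          ‖A'‖ < εf L i ∧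
          QTw i.1.1 i.1.2.1 i.1.2.2 i.2.2.le U₀ A' = (fun c => mlog (((unitsField (toUField V) c * (unitsField (toUField (descendTo i.1.1 ℰp i.1.2.1 i.1.2.2 i.2.2.le U₀)) c)⁻¹ :
              (Matrix (Fin 2) (Fin 2) ℂ)ˣ) : Matrix (Fin 2) (Fin 2) ℂ))) ∧
          (∀ b : PBond (i.1.1.P i.1.2.2) 0, (X b).IsHermitian ∧ Matrix.trace (X b) = 0) ∧
          A' - H (Dfix (CmapTw i.1.1 i.1.2.1 i.1.2.2 i.2.2.le U₀) H (C2f L i) A') = (fun b => Complex.I • X b) ∧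
          nMax19 i.1.1 i.1.2.1 i.1.2.2 U₀ X ≤ M L * (‖A₁‖ + ‖H₁f L i U₀ (fun c : PBond (i.1.1.P i.1.2.1) 0 =>
            (-Complex.I) • mlog (((V c : Matrix.specialUnitaryGroup (Fin 2) ℂ) : Matrix (Fin 2) (Fin 2) ℂ)
              * star ((descendTo i.1.1 ℰp i.1.2.1 i.1.2.2 i.2.2.le U₀ c : Matrix.specialUnitaryGroup (Fin 2) ℂ) : Matrix (Fin 2) (Fin 2) ℂ)))‖) ∧
          IsLandauPrint i.1.1 i.1.2.1 i.1.2.2 U₀ X ∧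
          (∀ u : GaugeTransf (i.1.1.P i.1.2.2) 0 (Matrix.specialUnitaryGroup (Fin 2) ℂ), RestrictedPrint i.1.1 i.1.2.1 i.1.2.2 U₀ u →
            GaugeField.gaugeAct u (emb15 U₀ (expHermField X)) ∈ fibre i.1.1 ℰp i.1.2.1 i.1.2.2 i.2.2.le V →
            ∀ γ : ℝ → GaugeField (i.1.1.P i.1.2.2) 0 (Matrix.specialUnitaryGroup (Fin 2) ℂ), γ 0 = GaugeField.gaugeAct u (emb15 U₀ (expHermField X)) →
              (∀ t, γ t ∈ fibre i.1.1 ℰp i.1.2.1 i.1.2.2 i.2.2.le V) →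
              (∀ b, DifferentiableAt ℝ (fun t => ((γ t b : Matrix.specialUnitaryGroup (Fin 2) ℂ) : Matrix (Fin 2) (Fin 2) ℂ)) 0) →
                deriv (fun t => wilsonAction4 (γ t)) 0 = 0))
    -- (ii) the (γ)-input of ★w4's `growth142_T3`, displayed member-uniformly (verbatim from the v1 knit)
    (hGrowth : ∀ (L : ℕ), 1 < L → ∀ (i : Idx L) (ε₁ ε₄ : ℝ) (V : GaugeField (i.1.1.P i.1.2.1) 0 (Matrix.specialUnitaryGroup (Fin 2) ℂ))
      (U₀ : GaugeField (i.1.1.P i.1.2.2) 0 (Matrix.specialUnitaryGroup (Fin 2) ℂ)) (X : PBond (i.1.1.P i.1.2.2) 0 → Matrix (Fin 2) (Fin 2) ℂ)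
      (u : GaugeTransf (i.1.1.P i.1.2.2) 0 (Matrix.specialUnitaryGroup (Fin 2) ℂ)) (W : GaugeField (i.1.1.P i.1.2.2) 0 (Matrix.specialUnitaryGroup (Fin 2) ℂ)),
      0 < ε₁ → ε₄ ≤ 1 / 4 → (L : ℝ) ^ 3 * (3 * (L : ℝ)) * ε₁ ≤ ε₄ → PlaqSmall ε₁ V → RegPr i.1.1 i.1.2.1 i.1.2.2 ((L : ℝ) ^ 3 * (3 * (L : ℝ)) * ε₁) U₀ →
      CloseAvg i.1.1 i.1.2.1 i.1.2.2 i.2.2.le ((L : ℝ) ^ 3 * ε₁) V U₀ → (∀ b : PBond (i.1.1.P i.1.2.2) 0, (X b).IsHermitian ∧ Matrix.trace (X b) = 0) →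
      nMax19 i.1.1 i.1.2.1 i.1.2.2 U₀ X < ε₄ → AvgCondPrint i.1.1 i.1.2.1 i.1.2.2 i.2.2.le V U₀ X → IsLandauPrint i.1.1 i.1.2.1 i.1.2.2 U₀ X →
      RestrictedPrint i.1.1 i.1.2.1 i.1.2.2 U₀ u → W = GaugeField.gaugeAct u (emb15 U₀ (expHermField X)) → IsAxialPrint i.1.1 i.1.2.1 i.1.2.2 U₀ W →
      W ∈ fibre i.1.1 ℰp i.1.2.1 i.1.2.2 i.2.2.le V →
      (∀ γ : ℝ → GaugeField (i.1.1.P i.1.2.2) 0 (Matrix.specialUnitaryGroup (Fin 2) ℂ), γ 0 = W → (∀ t, γ t ∈ fibre i.1.1 ℰp i.1.2.1 i.1.2.2 i.2.2.le V) →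
        (∀ b, DifferentiableAt ℝ (fun t => ((γ t b : Matrix.specialUnitaryGroup (Fin 2) ℂ) : Matrix (Fin 2) (Fin 2) ℂ)) 0) →
          deriv (fun t => wilsonAction4 (γ t)) 0 = 0) →
      ∀ W' : GaugeField (i.1.1.P i.1.2.2) 0 (Matrix.specialUnitaryGroup (Fin 2) ℂ), W' ∈ regFibrePr i.1.1 i.1.2.1 i.1.2.2 i.2.2.le (178 * ε₄) V →
        ∃ g : GaugeTransf (i.1.1.P i.1.2.2) 0 (Matrix.specialUnitaryGroup (Fin 2) ℂ), descTransf i.1.1 i.1.2.1 i.1.2.2 i.2.2.le g = (fun _ => 1) ∧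
          (∑ b : PBond (i.1.1.P i.1.2.2) 0, ‖pertVar W (GaugeField.gaugeAct g W') b‖ ^ 2 ≤
            CP L * ((i.1.1.L : ℝ) ^ (i.1.2.2 - i.1.2.1)) ^ 2 * ∑ p : Plaq (i.1.1.P i.1.2.2) 0,
              ‖((GaugeField.plaqHol (GaugeField.gaugeAct g W') p : Matrix.specialUnitaryGroup (Fin 2) ℂ) : Matrix (Fin 2) (Fin 2) ℂ)
                  * star ((GaugeField.plaqHol W p : Matrix.specialUnitaryGroup (Fin 2) ℂ) : Matrix (Fin 2) (Fin 2) ℂ) - 1‖ ^ 2) ∧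
          (-(θ L * ∑ p : Plaq (i.1.1.P i.1.2.2) 0,
              ‖((GaugeField.plaqHol (GaugeField.gaugeAct g W') p : Matrix.specialUnitaryGroup (Fin 2) ℂ) : Matrix (Fin 2) (Fin 2) ℂ)
                  * star ((GaugeField.plaqHol W p : Matrix.specialUnitaryGroup (Fin 2) ℂ) : Matrix (Fin 2) (Fin 2) ℂ) - 1‖ ^ 2) -
              (cS L * ε₄ * (((i.1.1.L : ℝ) ^ (i.1.2.2 - i.1.2.1)) ^ 2)⁻¹) * ∑ b : PBond (i.1.1.P i.1.2.2) 0, ‖pertVar W (GaugeField.gaugeAct g W') b‖ ^ 2 ≤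
            ∑ p : Plaq (i.1.1.P i.1.2.2) 0, (1 / 2) * ((((((GaugeField.plaqHol W p : Matrix.specialUnitaryGroup (Fin 2) ℂ) : Matrix (Fin 2) (Fin 2) ℂ)) - 1)ᴴ
              * (((((GaugeField.gaugeAct g W' ⟨p.src, p.μ⟩ : Matrix.specialUnitaryGroup (Fin 2) ℂ) : Matrix (Fin 2) (Fin 2) ℂ) * star (W ⟨p.src, p.μ⟩ : Matrix (Fin 2) (Fin 2) ℂ) - 1)
                  + (W ⟨p.src, p.μ⟩ : Matrix (Fin 2) (Fin 2) ℂ)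
                      * (((GaugeField.gaugeAct g W' ⟨p.src.shift p.μ, p.ν⟩ : Matrix.specialUnitaryGroup (Fin 2) ℂ) : Matrix (Fin 2) (Fin 2) ℂ) *
                          star (W ⟨p.src.shift p.μ, p.ν⟩ : Matrix (Fin 2) (Fin 2) ℂ) - 1)
                      * star (W ⟨p.src, p.μ⟩ : Matrix (Fin 2) (Fin 2) ℂ)
                  - ((W ⟨p.src, p.μ⟩ * W ⟨p.src.shift p.μ, p.ν⟩ * (W ⟨p.src.shift p.ν, p.μ⟩)⁻¹ : Matrix.specialUnitaryGroup (Fin 2) ℂ) :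
                        Matrix (Fin 2) (Fin 2) ℂ)
                      * (((GaugeField.gaugeAct g W' ⟨p.src.shift p.ν, p.μ⟩ : Matrix.specialUnitaryGroup (Fin 2) ℂ) : Matrix (Fin 2) (Fin 2) ℂ) *
                          star (W ⟨p.src.shift p.ν, p.μ⟩ : Matrix (Fin 2) (Fin 2) ℂ) - 1)
                      * star ((W ⟨p.src, p.μ⟩ * W ⟨p.src.shift p.μ, p.ν⟩ * (W ⟨p.src.shift p.ν, p.μ⟩)⁻¹ : Matrix.specialUnitaryGroup (Fin 2) ℂ) :
                        Matrix (Fin 2) (Fin 2) ℂ)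
                  - ((GaugeField.plaqHol W p : Matrix.specialUnitaryGroup (Fin 2) ℂ) : Matrix (Fin 2) (Fin 2) ℂ)
                      * (((GaugeField.gaugeAct g W' ⟨p.src, p.ν⟩ : Matrix.specialUnitaryGroup (Fin 2) ℂ) : Matrix (Fin 2) (Fin 2) ℂ) * star (W ⟨p.src, p.ν⟩ : Matrix (Fin 2) (Fin 2) ℂ) - 1)
                      * star ((GaugeField.plaqHol W p : Matrix.specialUnitaryGroup (Fin 2) ℂ) : Matrix (Fin 2) (Fin 2) ℂ))
                * ((GaugeField.plaqHol W p : Matrix.specialUnitaryGroup (Fin 2) ℂ) : Matrix (Fin 2) (Fin 2) ℂ))).trace).re))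
    -- (T2) the [B8] Thm 2 torus sockets, one `(B₁, c₁)` per `L`
    (hThm2 : ∀ (L : ℕ), 1 < L → ∃ B₁ c₁ : ℝ, 0 < B₁ ∧ 0 < c₁ ∧ ∀ (F : T3Family), F.L = L → ∀ (n K : ℕ), n < K →
      ∃ (β₀ B₂ : ℝ) (len : B7Prop1Explicit.Site (F.P K).d → ℝ),
        Thm2TorusAt (F.P K).L (K - n) ((((F.P K).sitesPerDir 0 : ℕ) : ℤ)) (eta F n K) β₀ B₁ B₂ c₁ len (specialUnitaryUnits (Fin 2)) (fun _ => True)) :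
    ∀ (L : ℕ), 1 < L → ∀ (B₃ : ℝ), 4 < B₃ → ∃ a₁' O₁ : ℝ, 0 < a₁' ∧ 1 ≤ O₁ ∧
    ∀ (F : T3Family), F.L = L → ∀ (n K : ℕ) (hnK : n < K) (ε₁ : ℝ), 0 < ε₁ →
      ∀ V : GaugeField (F.P n) 0 (Matrix.specialUnitaryGroup (Fin 2) ℂ), PlaqSmall ε₁ V →
        ∀ U₀ : GaugeField (F.P K) 0 (Matrix.specialUnitaryGroup (Fin 2) ℂ), RegPr F n K ((L : ℝ) ^ 3 * B₃ * ε₁) U₀ → U₀ ∈ fibre F ℰp n K hnK.le V →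
          ε₁ ≤ a₁' → ∃ U ∈ regFibrePr F n K hnK.le (O₁ * (L : ℝ) ^ 3 * B₃ * ε₁) V,
            IsMinOn (fun W : GaugeField (F.P K) 0 (Matrix.specialUnitaryGroup (Fin 2) ℂ) => wilsonAction4 W)
              (regFibrePr F n K hnK.le (O₁ * (L : ℝ) ^ 3 * B₃ * ε₁) V) U := by
  -- `stubEX_of_displayedRows_w` at the chart of record, `β := Λ_k`, `B := Bsym`; two rows to discharge: (B20) and CHART-112
  refine stubEX_of_displayedRows_w (fun L i => periodsT3 i.1.1 i.1.2.2) (fun L i => siteEquiv i.1.1 i.1.2.2) (fun L i x μ => siteEquiv_shiftEquiv i.1.1 i.1.2.2 x μ)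
    B₀ C₄ a₃ α r M CP θ cS hB₀ hC₄ ha₃ hα hr hM hCP hθ hcS 𝒢f Wf (fun L i => PBond (i.1.1.P i.1.2.1) 0) H₁f
    (fun L i V U₀ => fun c : PBond (i.1.1.P i.1.2.1) 0 =>
      (-Complex.I) • mlog (((V c : Matrix.specialUnitaryGroup (Fin 2) ℂ) : Matrix (Fin 2) (Fin 2) ℂ)
        * star ((descendTo i.1.1 ℰp i.1.2.1 i.1.2.2 i.2.2.le U₀ c : Matrix.specialUnitaryGroup (Fin 2) ℂ) : Matrix (Fin 2) (Fin 2) ℂ)))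
    norm_G prop4 norm_H₁ ?_ ?_ hGrowth hThm2
  · -- (B20) DISCHARGED at the letter `Bsym` (★w4-19200 g2), window `L³ε₁ ≤ α∕(3L) ≤ 1∕48` from WS `2α ≤ ⅛`
    intro L hL i ε₁ V U₀ hε₁ _hV _hreg hclose hαe
    have hFL' : (i.1.1.L : ℝ) = (L : ℝ) := by exact_mod_cast i.2.1
    have hL1 : (1 : ℝ) ≤ (L : ℝ) := by exact_mod_cast hL.le
    obtain ⟨-, -, s3, -⟩ := hwS L hL i
    have hwin : (i.1.1.L : ℝ) ^ 3 * ε₁ ≤ 1 / 2 := by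
      rw [hFL']
      have h3 : (L : ℝ) ^ 3 * ε₁ ≤ (L : ℝ) ^ 3 * (3 * (L : ℝ)) * ε₁ := by
        have h0 : 0 ≤ (L : ℝ) ^ 3 * ε₁ := by positivity
        nlinarith
      linarith
    have hclose' : CloseAvg i.1.1 i.1.2.1 i.1.2.2 i.2.2.le ((i.1.1.L : ℝ) ^ 3 * ε₁) V U₀ := by rw [hFL']; exact hclose
    have hB := bound20_symLog_of_closeAvg i.1.1 i.2.2.le hε₁ hwin V U₀ hclose'
    have hrad : (i.1.1.L : ℝ) ^ 3 * ε₁ = (L : ℝ) ^ 3 * ε₁ := by rw [hFL']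
    rw [hrad] at hB
    exact hB
  · -- CHART-112 DISCHARGED: (46)-tw ∃H, Prop. 3-tw, CHART-Σ (PROVED), the member-level knit `hChart_of_piecesTw`
    intro L hL i ε₁ V U₀ hε₁ hV hreg hclose hαe A₁ hA₁ hsol
    have hFL' : (i.1.1.L : ℝ) = (L : ℝ) := by exact_mod_cast i.2.1
    have hL0 : (0 : ℝ) < (L : ℝ) := by exact_mod_cast (show 0 < L by omega)
    have hL1 : (1 : ℝ) ≤ (L : ℝ) := by exact_mod_cast hL.le
    obtain ⟨s1, s2, s3, s4, s5, s6, s7, s8, s9⟩ := hwS L hL i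
    -- the background at the window radius `α L`
    have hregα : RegPr i.1.1 i.1.2.1 i.1.2.2 (α L) U₀ := regPr_mono i.1.1 hαe hreg
    -- (46)-tw and Prop. 3-tw at this background
    obtain ⟨H, hQH, hHB⟩ := h46tw L hL i U₀ hregα
    have h47 := h47tw L hL i U₀ H hregα hQH hHB
    -- CHART-Σ (PROVED)
    have hSig : ChartSigmaT3 i.1.1 i.1.2.1 i.1.2.2 (ef L) U₀ :=
      chartSigmaT3_of_regPr i.1.1 (hα L hL) (hef L hL) s1 s2 s3 s4 s5 s6 s7 s8 s9 U₀ hregα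
    -- ‖H₁B‖ ≤ 2B₀α from `norm_H₁` ∘ (B20) and `L³·3L·ε₁ ≤ α`
    have hwin : (i.1.1.L : ℝ) ^ 3 * ε₁ ≤ 1 / 2 := by
      rw [hFL']
      have h3 : (L : ℝ) ^ 3 * ε₁ ≤ (L : ℝ) ^ 3 * (3 * (L : ℝ)) * ε₁ := by
        have h0 : 0 ≤ (L : ℝ) ^ 3 * ε₁ := by positivity
        nlinarith
      linarith
    have hclose' : CloseAvg i.1.1 i.1.2.1 i.1.2.2 i.2.2.le ((i.1.1.L : ℝ) ^ 3 * ε₁) V U₀ := by rw [hFL']; exact hclose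
    have hB := bound20_symLog_of_closeAvg i.1.1 i.2.2.le hε₁ hwin V U₀ hclose'
    have hH₁B : ‖H₁f L i U₀ (fun c : PBond (i.1.1.P i.1.2.1) 0 =>
        (-Complex.I) • mlog (((V c : Matrix.specialUnitaryGroup (Fin 2) ℂ) : Matrix (Fin 2) (Fin 2) ℂ)
          * star ((descendTo i.1.1 ℰp i.1.2.1 i.1.2.2 i.2.2.le U₀ c : Matrix.specialUnitaryGroup (Fin 2) ℂ) : Matrix (Fin 2) (Fin 2) ℂ)))‖ ≤ 2 * B₀ L * α L := by
      have h0 := norm_H₁ L hL i _ U₀ hreg hαe (fun c : PBond (i.1.1.P i.1.2.1) 0 =>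
        (-Complex.I) • mlog (((V c : Matrix.specialUnitaryGroup (Fin 2) ℂ) : Matrix (Fin 2) (Fin 2) ℂ)
          * star ((descendTo i.1.1 ℰp i.1.2.1 i.1.2.2 i.2.2.le U₀ c : Matrix.specialUnitaryGroup (Fin 2) ℂ) : Matrix (Fin 2) (Fin 2) ℂ)))
      have hB' : ‖(fun c : PBond (i.1.1.P i.1.2.1) 0 =>
          (-Complex.I) • mlog (((V c : Matrix.specialUnitaryGroup (Fin 2) ℂ) : Matrix (Fin 2) (Fin 2) ℂ)
            * star ((descendTo i.1.1 ℰp i.1.2.1 i.1.2.2 i.2.2.le U₀ c : Matrix.specialUnitaryGroup (Fin 2) ℂ) : Matrix (Fin 2) (Fin 2) ℂ)))‖ ≤ 2 * α L := by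
        have h3 : 2 * ((3 : ℝ) * i.1.1.L) * ((i.1.1.L : ℝ) ^ 3 * ε₁) = 2 * ((L : ℝ) ^ 3 * (3 * (L : ℝ)) * ε₁) := by rw [hFL']; ring
        rw [h3] at hB
        linarith
      calc _ ≤ B₀ L * _ := h0
        _ ≤ B₀ L * (2 * α L) := mul_le_mul_of_nonneg_left hB' (hB₀ L hL).le
        _ = 2 * B₀ L * α L := by ring
    have hMe' : M L * (r L + ‖H₁f L i U₀ (fun c : PBond (i.1.1.P i.1.2.1) 0 =>
        (-Complex.I) • mlog (((V c : Matrix.specialUnitaryGroup (Fin 2) ℂ) : Matrix (Fin 2) (Fin 2) ℂ)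
          * star ((descendTo i.1.1 ℰp i.1.2.1 i.1.2.2 i.2.2.le U₀ c : Matrix.specialUnitaryGroup (Fin 2) ℂ) : Matrix (Fin 2) (Fin 2) ℂ)))‖) < ef L := by
      have : M L * (r L + ‖H₁f L i U₀ (fun c : PBond (i.1.1.P i.1.2.1) 0 =>
        (-Complex.I) • mlog (((V c : Matrix.specialUnitaryGroup (Fin 2) ℂ) : Matrix (Fin 2) (Fin 2) ℂ)
          * star ((descendTo i.1.1 ℰp i.1.2.1 i.1.2.2 i.2.2.le U₀ c : Matrix.specialUnitaryGroup (Fin 2) ℂ) : Matrix (Fin 2) (Fin 2) ℂ)))‖) ≤ M L * (r L + 2 * B₀ L * α L) :=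
        mul_le_mul_of_nonneg_left (by linarith) (hM L hL).le
      exact lt_of_le_of_lt this (hMe L hL)
    -- the numeric windows of the member-level knit
    have hα16 : α L ≤ 1 / 16 := by linarith
    have hb1 : (L : ℝ) ^ 3 * ε₁ ≤ 1 := by
      have h3 : (L : ℝ) ^ 3 * ε₁ ≤ (L : ℝ) ^ 3 * (3 * (L : ℝ)) * ε₁ := by
        have h0 : 0 ≤ (L : ℝ) ^ 3 * ε₁ := by positivity
        nlinarith
      linarith
    have hw137' : 10 ^ 7 * (i.1.1.L : ℝ) ^ 3 * (178 * (α L + ef L)) ≤ 1 := by rw [hFL']; exact hw137 L hL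
    exact hChart_of_piecesTw i.1.1 i.2.2.le (hα L hL) hα16 (hef L hL) s4 hb1 hw137' hregα hclose h47 hQH hSig (hwinTw L hL i U₀ · hregα)
      (hXtw L hL i ε₁ V U₀ H hε₁ hV hreg hclose hαe hQH hHB h47) (hM L hL).le hMe' A₁ hA₁ hsol

end Summit.QuantumFields.YangMills.Theorems.Prop7StubEXOfChartPiecesTw

end
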